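import Mathlib.Algebra.Order.Monoid.Unbundled.Pow
import Mathlib.Data.NNReal.Defs
import Mathlib.Data.NNRat.Order
import Literature.AlgebraicGeometry.Frobenioids.ModelFrobenioidIsFrobenioid
import Literature.AlgebraicGeometry.Frobenioids.ModelFrobenioidCofinal
import Literature.AlgebraicGeometry.Frobenioids.PadicFrobenioidThm12
import Literature.AlgebraicGeometry.Frobenioids.PadicFrobenioidDatumLemmas
import HarnessLib

/-!
# Frobenioids II, Example 1.1 (ii): the `p`-adic Frobenioid is a Frobenioid

Mochizuki, *The geometry of Frobenioids II*, Kyushu J. Math. **62** (2008), §1, Example 1.1 (ii),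
kurims p. 8 [cite: MochizukiFrdII2008, Ex 1.1 (ii) p.8]: "We shall refer to as a *`p`-adic Frobenioid*
the Frobenioid `C` that arises as the model Frobenioid associated to this data `Φ`, `B → Φ^gp` [cf.
[FrdI], Theorem 5.2, (ii)]." PROOF-ONLY assembly (node `FrdII:Ex1.1(ii)`, input (α) of Thm. 1.2 (iv);
seat abc-iut-L1-d8): found's [FrdI] Thm. 5.2 (ii) `ModelFrobenioid.isFrobenioid` applied to a
`PadicFrd.Datum d` under abc-iut-L1-t4's standing hypothesis `d.IsMonoidData` ("`Φ`, `B` are monoids on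
`D`", Def. 1.1 (ii)); the remaining hypotheses are discharged here: `Φ` is divisorial since it is
monoprime (`IsMonoprime.isDivisorial`: `ℤ_{≥0}, ℚ_{≥0}, ℝ_{≥0}` are integral, saturated, of
characteristic type and sharp), `B` is group-like since every element of `B(A) = K^× ×_{Φ₀^gp} Φ^gp` is a
unit (`isGroupLike_of_forall_isUnit` + abc-iut-L1-d10's `Datum.isUnit_B`), and `D` is connected and
totally epimorphic by the datum. No definitions.
-/

namespace Literature.AlgebraicGeometry.Frobenioids

open CategoryTheory Opposite

universe w v u

/-! ### Monoprime monoids are divisorial; groups are group-like -/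

section Monoids

variable {M : Type w} [CommMonoid M]

/-- Transport: a monoid isomorphic to `Λ_{≥0}` (multiplicatively written), `Λ` canonically linearly
ordered and cancellative, is divisorial — integral, saturated, of characteristic type and sharp
([FrdI] Def. 1.1 (i)). [cite: MochizukiFrdI2008, Def. 1.1(i) p.19] -/
private theorem isDivisorial_of_mulEquiv_multiplicative {Λ : Type*} [AddCommMonoid Λ] [LinearOrder Λ]
    [CanonicallyOrderedAdd Λ] [IsOrderedCancelAddMonoid Λ] (e : M ≃* Multiplicative Λ) :
    IsDivisorial M := by
  have hsharp : IsSharp M := ⟨fun a ha => by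
    obtain ⟨u, rfl⟩ := ha
    have h : Multiplicative.toAdd (e (u : M)) + Multiplicative.toAdd (e (↑u⁻¹ : M)) = 0 := by
      rw [← toAdd_mul, ← map_mul, Units.mul_inv, map_one, toAdd_one]
    exact e.injective (by rw [map_one]; exact Multiplicative.toAdd.injective (add_eq_zero.mp h).1)⟩
  haveI : IsCancelMul M :=
    { mul_left_cancel := fun a b c h => by
        dsimp only at h
        have h' := congrArg (fun x => Multiplicative.toAdd (e x)) h
        simp only [map_mul, toAdd_mul] at h'
        exact e.injective (Multiplicative.toAdd.injective (add_left_cancel h'))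
      mul_right_cancel := fun a b c h => by
        dsimp only at h
        have h' := congrArg (fun x => Multiplicative.toAdd (e x)) h
        simp only [map_mul, toAdd_mul] at h'
        exact e.injective (Multiplicative.toAdd.injective (add_right_cancel h')) }
  refine ⟨⟨isIntegral_iff_isCancelMul.mpr inferInstance, ⟨fun x n hn ⟨m, hm⟩ => ?_⟩,
    ⟨fun u a _ => ?_⟩⟩, hsharp⟩
  · -- saturated: `x^n = m` with `x = a/b` forces `b ≤ a`, so `x = a - b ≥ 0`
    obtain ⟨a, b, hab⟩ := grothendieckGroup_exists_mul_of_eq_of x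
    have hx : x = Algebra.GrothendieckGroup.of a * (Algebra.GrothendieckGroup.of b)⁻¹ :=
      eq_mul_inv_of_mul_eq hab
    have key : a ^ n = m * b ^ n := by
      apply Algebra.GrothendieckGroup.of_injective
      rw [map_mul, map_pow, map_pow, hm, hx, mul_pow, inv_pow, inv_mul_cancel_right]
    have hle : Multiplicative.toAdd (e b) ≤ Multiplicative.toAdd (e a) := by
      have h2 : n • Multiplicative.toAdd (e b) ≤ n • Multiplicative.toAdd (e a) := by
        rw [← toAdd_pow, ← toAdd_pow, ← map_pow, ← map_pow, key, map_mul, toAdd_mul]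
        exact le_add_self
      exact le_of_nsmul_le_nsmul_right hn.ne' h2
    obtain ⟨c, hc⟩ := le_iff_exists_add.mp hle
    refine ⟨e.symm (Multiplicative.ofAdd c), ?_⟩
    rw [hx, eq_mul_inv_iff_mul_eq, ← map_mul]
    congr 1
    apply e.injective
    rw [map_mul, MulEquiv.apply_symm_apply]
    exact Multiplicative.toAdd.injective (by rw [toAdd_mul, toAdd_ofAdd, hc, add_comm])
  · -- characteristic type: units are trivial
    exact Units.ext (hsharp.1 _ u.isUnit)

/-- A monoprime monoid (`≅ ℤ_{≥0}, ℚ_{≥0}` or `ℝ_{≥0}`, [FrdI] §0 p. 10) is divisorial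
([FrdI] Def. 1.1 (i)). [cite: MochizukiFrdI2008, Def. 1.1(i) p.19] -/
theorem IsMonoprime.isDivisorial (h : IsMonoprime M) : IsDivisorial M := by
  rcases h with ⟨⟨⟨e⟩⟩⟩ | ⟨⟨⟨e⟩⟩⟩ | ⟨⟨⟨e⟩⟩⟩
  · exact isDivisorial_of_mulEquiv_multiplicative e
  · exact isDivisorial_of_mulEquiv_multiplicative e
  · exact isDivisorial_of_mulEquiv_multiplicative e

/-- A commutative monoid all of whose elements are units is group-like ([FrdI] Def. 1.1 (i):
pre-divisorial with `M^char = 0`). [cite: MochizukiFrdI2008, Def. 1.1(i) p.19] -/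
theorem isGroupLike_of_forall_isUnit (h : ∀ b : M, IsUnit b) : IsGroupLike M := by
  haveI : IsCancelMul M :=
    { mul_left_cancel := fun a b c habc => (h a).mul_left_cancel (by simpa only using habc)
      mul_right_cancel := fun a b c habc => (h a).mul_right_cancel (by simpa only using habc) }
  refine ⟨⟨isIntegral_iff_isCancelMul.mpr inferInstance, ⟨fun x n _ _ => ?_⟩, ⟨fun u a hua => ?_⟩⟩,
    ⟨fun x y => ?_⟩⟩
  · obtain ⟨a, b, hab⟩ := grothendieckGroup_exists_mul_of_eq_of x
    obtain ⟨v, hv⟩ := h b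
    refine ⟨a * ↑v⁻¹, ?_⟩
    rw [map_mul, map_units_inv, hv, mul_inv_eq_iff_eq_mul]
    exact hab.symm
  · have : (u : M) * a = 1 * a := by rw [hua, one_mul]
    exact Units.ext ((h a).mul_right_cancel this)
  · obtain ⟨a, rfl⟩ := Associates.mk_surjective x
    obtain ⟨b, rfl⟩ := Associates.mk_surjective y
    obtain ⟨ua, hua⟩ := h a
    obtain ⟨ub, hub⟩ := h b
    exact Associates.mk_eq_mk_iff_associated.mpr ⟨ua⁻¹ * ub, by
      rw [← hua, Units.val_mul, ← mul_assoc, Units.mul_inv, one_mul, hub]⟩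

end Monoids

/-! ### The `p`-adic Frobenioid is a Frobenioid -/

namespace PadicFrd

namespace Datum

variable {D : Type u} [Category.{v} D] {p : ℕ} [Fact p.Prime] (d : Datum D p)

/-- **Example 1.1 (ii)** (FrdII p. 8): "the Frobenioid `C` that arises as the model Frobenioid
associated to this data" — the `p`-adic Frobenioid `d.frobenioid → F_Φ` IS a Frobenioid, by [FrdI]
Thm. 5.2 (ii) (found's `ModelFrobenioid.isFrobenioid`), given that `Φ` and `B` are monoids on `D`
(`d.IsMonoidData`, the standing requirement of Thm. 5.2): `Φ` is divisorial (monoprime), `B` is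
group-like (`B(A) = K^× ×_{Φ₀^gp} Φ^gp`), `D` is connected and totally epimorphic.
[cite: MochizukiFrdII2008, Ex 1.1 (ii) p.8] -/
theorem isFrobenioid_of_isMonoidData (h : d.IsMonoidData) :
    PreFrobenioid.IsFrobenioid d.structureFunctor :=
  ModelFrobenioid.isFrobenioid h.1 (fun A => (d.isMonoprime (op A)).isDivisorial) h.2
    (fun A => isGroupLike_of_forall_isUnit (d.isUnit_B (op A)))
    (isGraphConnected_iff_isConnected.mpr d.isConnected_base) d.isTotallyEpimorphic_base

end Datum

end PadicFrd

end Literature.AlgebraicGeometry.Frobenioids
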